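import Summits.Ventures.PercRepro.C041ZoneSplitMain

/-!
# Side `b` by symmetry: (INV) tail-free ⟸ ZONE LEMMA on both sides (p6, gen 26; C-041.md §11)

The definitions of the O-cube are symmetric in the two terminals: `Bare`, the zones, `K`, `IsCubeState`, `RcInvalid`,
`TailFree` exchange `a` and `b` verbatim (`bare_comm`, `blueBareConn_comm`, `bareReach_comm`, `isCubeState_comm`,
`cubeStateSet_comm`, `invalidCount_comm`), and `m_b(u)` for `(a, b)` is `m_a(u)` for `(b, a)` (`mCountA_comm`).  Hence
the side-`a` theorem of `C041ZoneSplitMain` applied to the skeleton `(G; b, a, c)` gives side `b`: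

* **`invalidCount_le_mCountB_of_zone`**: `I(O) ≤ m_b(u)` for a tail-free `O`, an edge between the terminals, `u ∈ K₀`,
  and the ZONE LEMMA on the indexed zones of `O` read on side `b` (`Lset b a c O` / `Rset b a c O`);
* **`inv_of_zone`**: both (INV) inequalities at `(O, u)` from the ZONE LEMMA on both sides — mine-3's
  «(INV) for every tail-free `(G⁺, O)` and every `u″`, `t`» (C-041.md §11) in the tree.
-/

namespace PercRepro

namespace MultiGraph

open Finset

variable {V E : Type*} {G : MultiGraph V E}

section Symm

variable (a b c : V)

/-- `Bare` is symmetric in the terminals. -/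
theorem bare_comm : G.Bare b a = G.Bare a b := by
  funext e
  unfold Bare
  exact propext And.comm

/-- Blue bare adjacency is symmetric in the terminals. -/
theorem blueBareAdj_comm (O : Config E) : G.BlueBareAdj b a O = G.BlueBareAdj a b O := by
  unfold BlueBareAdj
  rw [bare_comm]

/-- The zones are symmetric in the terminals. -/
theorem blueBareConn_comm (O : Config E) : G.BlueBareConn b a O = G.BlueBareConn a b O := by
  unfold BlueBareConn
  rw [blueBareAdj_comm]

/-- Red bare adjacency is symmetric in the terminals. -/
theorem bareAdj_comm (S : Config E) : G.BareAdj b a S = G.BareAdj a b S := by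
  unfold BareAdj
  rw [bare_comm]

/-- `K` is symmetric in the terminals. -/
theorem bareReach_comm (S : Config E) : G.BareReach b a c S = G.BareReach a b c S := by
  unfold BareReach
  rw [bareAdj_comm]

/-- The interior blue edges are symmetric in the terminals. -/
theorem interiorBlue_comm (O : Config E) : G.InteriorBlue b a O = G.InteriorBlue a b O := by
  funext e
  unfold InteriorBlue
  rw [bare_comm, blueBareConn_comm]
  apply propext
  constructor
  · rintro ⟨h1, h2, u, ⟨e', he'⟩, h3⟩
    exact ⟨h1, h2, u, ⟨e', he'.symm⟩, h3⟩
  · rintro ⟨h1, h2, u, ⟨e', he'⟩, h3⟩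
    exact ⟨h1, h2, u, ⟨e', he'.symm⟩, h3⟩

/-- The cube states are symmetric in the terminals. -/
theorem isCubeState_comm (O S : Config E) : G.IsCubeState b a c O S ↔ G.IsCubeState a b c O S := by
  unfold IsCubeState
  rw [bare_comm, interiorBlue_comm]
  constructor
  · rintro ⟨h1, h2, h3, h4, h5⟩
    exact ⟨h1, h2, h4, h3, fun h => h5 h.symm⟩
  · rintro ⟨h1, h2, h3, h4, h5⟩
    exact ⟨h1, h2, h4, h3, fun h => h5 h.symm⟩

open Classical in
/-- The set of cube states is symmetric in the terminals. -/
theorem cubeStateSet_comm [Fintype V] [Fintype E] [DecidableEq E] (O : Config E) :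
    G.cubeStateSet b a c O = G.cubeStateSet a b c O := by
  unfold cubeStateSet
  exact Finset.filter_congr fun S _ => isCubeState_comm a b c O S

/-- Invalidity is symmetric in the terminals. -/
theorem rcInvalid_comm (S : Config E) : G.RcInvalid b a c S ↔ G.RcInvalid a b c S := by
  unfold RcInvalid
  rw [and_comm]

open Classical in
/-- `I(O)` is symmetric in the terminals. -/
theorem invalidCount_comm [Fintype V] [Fintype E] [DecidableEq E] (O : Config E) :
    G.invalidCount b a c O = G.invalidCount a b c O := by
  unfold invalidCount
  rw [cubeStateSet_comm]
  congr 1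
  exact Finset.filter_congr fun S _ => rcInvalid_comm a b c S

open Classical in
/-- `m_a(u)` for the skeleton `(G; b, a, c)` is `m_b(u)` for `(G; a, b, c)`. -/
theorem mCountA_comm [Fintype V] [Fintype E] [DecidableEq E] (O : Config E) (u : V) :
    G.mCountA b a c O u = G.mCountB a b c O u := by
  unfold mCountA mCountB
  rw [cubeStateSet_comm]
  congr 1

/-- Tail-freeness is symmetric in the terminals. -/
theorem tailFree_comm (O : Config E) : G.TailFree b a c O ↔ G.TailFree a b c O := by
  unfold TailFree
  rw [bare_comm, bareReach_comm]

/-- **(INV) TAIL-FREE ⟸ ZONE LEMMA, side `b`**: `I(O) ≤ m_b(u)` for a tail-free `O`, an edge between the terminals,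
`u ∈ K₀`, and the ZONE LEMMA on the indexed zones of `O` read on side `b`. -/
theorem invalidCount_le_mCountB_of_zone [Fintype V] [Fintype E] [DecidableEq E] {O : Config E}
    (hc : c ≠ a ∧ c ≠ b) (hne : a ≠ b) (hab : ∃ e, G.Joins e a b) (hO : G.TailFree a b c O) {u : V}
    (hu : u ∈ G.BareReach a b c O)
    (hLR : ∀ Z : G.ZoneIdx b a c O, (G.Lset b a c O Z.1).card ≤ (G.Rset b a c O Z.1).card) :
    G.invalidCount a b c O ≤ G.mCountB a b c O u := by
  obtain ⟨e, he⟩ := hab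
  have h := invalidCount_le_mCountA_of_zone b a c ⟨hc.2, hc.1⟩ hne.symm ⟨e, he.symm⟩
    ((tailFree_comm a b c O).2 hO) (by rw [bareReach_comm]; exact hu) hLR
  rw [invalidCount_comm, mCountA_comm] at h
  exact h

/-- **(INV) TAIL-FREE ⟸ ZONE LEMMA, both sides** (C-041.md §11): for a tail-free `O`, an edge between the terminals
and `u ∈ K₀`, the ZONE LEMMA on the indexed zones of `O` on both sides gives both (INV) inequalities at `(O, u)` —
the conjunct of `INVConj` at `(O, u)`. -/
theorem inv_of_zone [Fintype V] [Fintype E] [DecidableEq E] {O : Config E} (hc : c ≠ a ∧ c ≠ b) (hne : a ≠ b)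
    (hab : ∃ e, G.Joins e a b) (hO : G.TailFree a b c O) {u : V} (hu : u ∈ G.BareReach a b c O)
    (hLRa : ∀ Z : G.ZoneIdx a b c O, (G.Lset a b c O Z.1).card ≤ (G.Rset a b c O Z.1).card)
    (hLRb : ∀ Z : G.ZoneIdx b a c O, (G.Lset b a c O Z.1).card ≤ (G.Rset b a c O Z.1).card) :
    G.invalidCount a b c O ≤ G.mCountA a b c O u ∧ G.invalidCount a b c O ≤ G.mCountB a b c O u :=
  ⟨invalidCount_le_mCountA_of_zone a b c hc hne hab hO hu hLRa,
    invalidCount_le_mCountB_of_zone a b c hc hne hab hO hu hLRb⟩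

end Symm

end MultiGraph

end PercRepro
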